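import Literature.NumberTheory.LFunctions.IncompleteKloostermanSmooth
import Literature.NumberTheory.Sieve.KloostermanQuintilinearSmooth
import HarnessLib

/-!
# Tools for Drappeau 2017, §4.3.3: the terms `𝒜₀` and `𝒜_∞`

Topic `Literature/NumberTheory/Sieve`.  Elementary estimates used in the proof of S. Drappeau,
Proc. LMS (3) 114 (2017) 684–732 = arXiv:1504.05549, Theorem 2.1 (§4.3.3, p. 15 of the arXiv
version) — the named fact `Literature.NumberTheory.Sieve.AssingBlomerLi2020_theorem23` — after the
Poisson summation `KloostermanQuintilinearCongruencesPoisson.poisson_completion`: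

* the zero frequency `𝒜₀`: `|S(0, n r̄; sc)| ≤ (n, sc)` (Ramanujan sums; with the gcd kept, the
  correction of Bombieri–Friedlander–Iwaniec 2019 recorded by Assing–Blomer–Li after their Lemma 13),
  `(n, sc) ≤ (n, s)(n, c)`, and the gcd sums `∑_{c ≤ X} (n, c) ≤ τ(n) X`,
  `∑_{s ≤ X} (n, s)² ≤ τ(n) X²`;
* the large frequencies `𝒜_∞`: the tail `‖∑_{|h| > K} 𝓕F(h/d) w(h)‖ ≤ 4 sup|w| ‖F⁽ᵏ⁾‖₁ (d/2π)ᵏ K^{1-k}`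
  of a Poisson-dual sum against bounded weights (repeated integration by parts, from
  `FriedlanderIwaniecPrimes.sum_tail_norm_fourier_div_le`);
* the substitution `𝓕F(y) = a ∫ F(av) e(−avy) dv` used for the middle frequencies;
* slices `d ↦ g(c,d,n,r,s)` of a five-variable weight: smoothness, compact support, and the
  `L¹` bounds of their derivatives from bounds on `KloostermanQuintilinear.mixedDeriv`.

Everything PROVED ([folklore] unless cited), no definition, no named fact, standard axioms.

## References

* S. Drappeau, Proc. LMS (3) 114 (2017) 684–732, §4.3.3. [cite: Drappeau2017, §4.3.3]
* E. Assing, V. Blomer, J. Li, Adv. Math. 393 (2021) 108076, remark after Lemma 13 (the `𝒜₀`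
  correction of [BFI3]). [cite: AssingBlomerLi2020, §3.3]
-/

noncomputable section

open Real MeasureTheory Filter Complex Finset
open scoped FourierTransform Topology ContDiff

namespace Literature.NumberTheory.Sieve

namespace KloostermanQuintilinear

open Literature.NumberTheory.LFunctions (kloostermanSum)
open Literature.NumberTheory.LFunctions.MatomakiMerikoski (norm_kloostermanSum_zero_left_le
  MatomakiMerikoski2023_lemma37_i integral_norm_le_of_support)
open Literature.NumberTheory.Sieve.FriedlanderIwaniecPrimes (summable_fourier_div
  sum_tail_norm_fourier_div_le fourier_comp_affine integrable_iteratedDeriv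
  hasCompactSupport_iteratedDeriv norm_fourier_le_integral_norm)

/-! ### The substitution for the middle frequencies -/

/-- `𝓕F(y) = a · ∫ e(−v·(ay)) F(av) dv` for `a > 0` (the substitution `x = av`). [folklore] -/
theorem fourier_eq_mul_integral_comp_mul (F : ℝ → ℂ) {a : ℝ} (ha : 0 < a) (y : ℝ) :
    𝓕 F y = (a : ℂ) * ∫ v : ℝ, 𝐞 (-(v * (a * y))) • F (a * v) := by
  have h := fourier_comp_affine F ha 0 (a * y)
  simp only [zero_add, zero_mul, zero_div, AddChar.map_zero_eq_one, Circle.coe_one, mul_one] at h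
  rw [mul_div_cancel_left₀ y ha.ne'] at h
  rw [← Real.fourier_real_eq, h, ← mul_assoc]
  have ha' : (a : ℂ) ≠ 0 := by exact_mod_cast ha.ne'
  rw [mul_inv_cancel₀ ha', one_mul]

/-! ### The tail of the dual sum against bounded weights -/

/-- **Large frequencies.**  For `F` smooth with compact support, `k ≥ 2`, `d > 0`, `K ≥ 1` and
weights `w` with `|w| ≤ C_w` vanishing for `|h| ≤ K`:
`‖∑_{h ∈ ℤ} 𝓕F(h/d) w(h)‖ ≤ C_w · 4 ‖F⁽ᵏ⁾‖₁ (d/(2π))ᵏ K^{1−k}`. [folklore] -/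
theorem norm_tsum_fourier_mul_le_of_vanish {F : ℝ → ℂ} (hF : ContDiff ℝ ∞ F)
    (hFc : HasCompactSupport F) {k : ℕ} (hk : 2 ≤ k) {d : ℝ} (hd : 0 < d) {K : ℕ} (hK : 1 ≤ K)
    {w : ℤ → ℂ} {Cw : ℝ} (hCw : 0 ≤ Cw) (hw : ∀ h, ‖w h‖ ≤ Cw)
    (hw0 : ∀ h : ℤ, h.natAbs ≤ K → w h = 0) :
    ‖∑' h : ℤ, 𝓕 F ((h : ℝ) / d) * w h‖ ≤
      Cw * (4 * (∫ t, ‖iteratedDeriv k F t‖) * (d / (2 * π)) ^ k * ((K : ℝ) ^ (k - 1))⁻¹) := by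
  classical
  set f : ℤ → ℝ := fun h => ‖𝓕 F ((h : ℝ) / d)‖ with hf
  have hf0 : ∀ h, 0 ≤ f h := fun h => norm_nonneg _
  have hsumF : Summable fun h : ℤ => 𝓕 F ((h : ℝ) / d) := summable_fourier_div hF hFc hd
  have hsum : Summable fun h : ℤ => 𝓕 F ((h : ℝ) / d) * w h := by
    refine Summable.of_norm_bounded (g := fun h => Cw * f h) (hsumF.norm.mul_left Cw) fun h => ?_
    rw [norm_mul, mul_comm]
    exact mul_le_mul_of_nonneg_right (hw h) (norm_nonneg _)
  refine (norm_tsum_le_tsum_norm hsum.norm).trans ?_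
  refine hsum.norm.tsum_le_of_sum_le fun u => ?_
  set Tail : ℝ := 2 * (∫ t, ‖iteratedDeriv k F t‖) * (d / (2 * π)) ^ k * ((K : ℝ) ^ (k - 1))⁻¹
    with hTail
  have hTail0 : 0 ≤ Tail := by positivity
  -- Step 1: termwise comparison with the indicator of `|h| > K`
  have hterm : ∀ h ∈ u, ‖𝓕 F ((h : ℝ) / d) * w h‖ ≤
      Cw * (if K < h.natAbs then f h else 0) := by
    intro h _
    by_cases hh : K < h.natAbs
    · rw [if_pos hh, norm_mul, mul_comm]
      exact mul_le_mul_of_nonneg_right (hw h) (hf0 h)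
    · rw [if_neg hh, hw0 h (not_lt.mp hh)]
      simp
  refine (Finset.sum_le_sum hterm).trans ?_
  rw [← Finset.mul_sum]
  have hgoal : ∑ h ∈ u, (if K < h.natAbs then f h else 0) ≤ 2 * Tail := by
    set N : ℕ := u.sup fun h : ℤ => h.natAbs with hN
    have hNle : ∀ h ∈ u, h.natAbs ≤ N := fun h hh => Finset.le_sup (f := fun h : ℤ => h.natAbs) hh
    have htail : ∑ j ∈ Finset.Ioc K N, (f j + f (-(j : ℤ))) ≤ Tail := by
      have := sum_tail_norm_fourier_div_le hF hFc hk hd hK N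
      refine le_trans (le_of_eq ?_) this
      refine Finset.sum_congr rfl fun j _ => ?_
      simp only [hf]
      push_cast
      rw [neg_div]
    -- Step 2: symmetrise (`f h ≤ f |h| + f(−|h|)`) and use that `natAbs` is at most two-to-one
    set G : ℕ → ℝ := fun j => if K < j then f j + f (-(j : ℤ)) else 0 with hG
    have hG0 : ∀ j, 0 ≤ G j := fun j => by
      simp only [hG]
      split_ifs
      · exact add_nonneg (hf0 _) (hf0 _)
      · exact le_rfl
    have h1 : ∀ h ∈ u, (if K < h.natAbs then f h else 0) ≤ G h.natAbs := by
      intro h _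
      simp only [hG]
      split_ifs with hh
      · rcases Int.natAbs_eq h with e | e
        · calc f h = f (h.natAbs : ℤ) := by rw [← e]
            _ ≤ f (h.natAbs : ℤ) + f (-(h.natAbs : ℤ)) := le_add_of_nonneg_right (hf0 _)
        · calc f h = f (-(h.natAbs : ℤ)) := by rw [← e]
            _ ≤ f (h.natAbs : ℤ) + f (-(h.natAbs : ℤ)) := le_add_of_nonneg_left (hf0 _)
      · exact le_rfl
    refine (Finset.sum_le_sum h1).trans ?_
    rw [Finset.sum_comp (f := G) (g := fun h : ℤ => h.natAbs)]
    have h2 : ∀ j ∈ u.image (fun h : ℤ => h.natAbs),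
        (u.filter fun h : ℤ => h.natAbs = j).card • G j ≤ 2 * G j := by
      intro j _
      rw [nsmul_eq_mul]
      refine mul_le_mul_of_nonneg_right ?_ (hG0 j)
      have hsub : (u.filter fun h : ℤ => h.natAbs = j) ⊆ ({(j : ℤ), -(j : ℤ)} : Finset ℤ) := by
        intro h hh
        rw [Finset.mem_filter] at hh
        rw [Finset.mem_insert, Finset.mem_singleton]
        rcases Int.natAbs_eq h with e | e
        · left; rw [e, hh.2]
        · right; rw [e, hh.2]
      have := (Finset.card_le_card hsub).trans (Finset.card_le_two (a := (j : ℤ)) (b := -(j : ℤ)))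
      exact_mod_cast this
    refine (Finset.sum_le_sum h2).trans ?_
    rw [← Finset.mul_sum]
    refine mul_le_mul_of_nonneg_left ?_ (by norm_num)
    refine le_trans ?_ htail
    rw [show ∑ j ∈ u.image (fun h : ℤ => h.natAbs), G j =
        ∑ j ∈ (u.image fun h : ℤ => h.natAbs).filter (fun j => K < j), (f j + f (-(j : ℤ))) from
      (Finset.sum_filter _ _).symm]
    refine Finset.sum_le_sum_of_subset_of_nonneg ?_ fun j _ _ => add_nonneg (hf0 _) (hf0 _)
    intro j hj
    rw [Finset.mem_filter, Finset.mem_image] at hj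
    obtain ⟨⟨h, hh, rfl⟩, hKj⟩ := hj
    exact Finset.mem_Ioc.mpr ⟨hKj, hNle h hh⟩
  calc Cw * ∑ h ∈ u, (if K < h.natAbs then f h else 0) ≤ Cw * (2 * Tail) :=
        mul_le_mul_of_nonneg_left hgoal hCw
    _ = Cw * (4 * (∫ t, ‖iteratedDeriv k F t‖) * (d / (2 * π)) ^ k * ((K : ℝ) ^ (k - 1))⁻¹) := by
        rw [hTail]; ring

/-! ### The zero frequency: Ramanujan sums and gcd sums -/

/-- `gcd (x mod N, N) = gcd (x, N)`. [folklore] -/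
theorem gcd_mod_left_eq (x N : ℕ) : Nat.gcd (x % N) N = Nat.gcd x N := by
  rw [← Nat.gcd_rec, Nat.gcd_comm]

/-- **`𝒜₀`: Ramanujan sums.** `|S(0, n r̄; N)| ≤ (n, N)` for `(r, N) = 1` (the gcd is kept:
this is the point corrected in [BFI3], cf. the remark after Lemma 13 of Assing–Blomer–Li).
[cite: AssingBlomerLi2020, §3.3] -/
theorem norm_kloostermanSum_zero_mul_inv_le {N : ℕ} [NeZero N] {r : ℕ} (hr : r.Coprime N)
    (n : ℕ) : ‖kloostermanSum N 0 ((n : ZMod N) * (r : ZMod N)⁻¹)‖ ≤ Nat.gcd n N := by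
  refine (norm_kloostermanSum_zero_left_le N _).trans ?_
  have hru : IsUnit (r : ZMod N) := (ZMod.isUnit_iff_coprime r N).mpr hr
  obtain ⟨u, hu⟩ := hru
  have hinv : ((r : ZMod N))⁻¹ = ((u⁻¹ : (ZMod N)ˣ) : ZMod N) := by rw [← hu, ZMod.inv_coe_unit]
  have hcop : Nat.Coprime ((u⁻¹ : (ZMod N)ˣ) : ZMod N).val N := ZMod.val_coe_unit_coprime _
  have hval : ((n : ZMod N) * (r : ZMod N)⁻¹).val =
      (n % N * ((u⁻¹ : (ZMod N)ˣ) : ZMod N).val) % N := by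
    rw [hinv, ZMod.val_mul, ZMod.val_natCast]
  rw [hval, gcd_mod_left_eq, Nat.Coprime.gcd_mul_right_cancel _ hcop, gcd_mod_left_eq]

/-- `(n, sc) ≤ (n, s)(n, c)` for `n ≥ 1`. [folklore] -/
theorem gcd_mul_right_le {n : ℕ} (hn : n ≠ 0) (s c : ℕ) :
    Nat.gcd n (s * c) ≤ Nat.gcd n s * Nat.gcd n c := by
  have hn' : 0 < n := Nat.pos_of_ne_zero hn
  exact Nat.le_of_dvd (Nat.mul_pos (Nat.gcd_pos_of_pos_left _ hn') (Nat.gcd_pos_of_pos_left _ hn'))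
    (gcd_mul_dvd_mul_gcd n s c)

/-- **gcd sum over a dyadic range**: `∑_{C < c ≤ 2C} (n, c)/c ≤ 2 τ(n)` for `n ≥ 1`, `C ≥ 1`
(from `∑_{c ≤ 2C} (n, c) ≤ τ(n)·2C`, `MatomakiMerikoski2023_lemma37_i`). [folklore] -/
theorem sum_gcd_div_le {n : ℕ} (hn : n ≠ 0) {C : ℝ} (hC : 1 ≤ C) :
    ∑ c ∈ (Finset.Icc 1 ⌊2 * C⌋₊).filter (fun c : ℕ => C < c), (Nat.gcd n c : ℝ) / c ≤
      2 * #n.divisors := by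
  have hC0 : 0 < C := by linarith
  calc ∑ c ∈ (Finset.Icc 1 ⌊2 * C⌋₊).filter (fun c : ℕ => C < c), (Nat.gcd n c : ℝ) / c
      ≤ ∑ c ∈ (Finset.Icc 1 ⌊2 * C⌋₊).filter (fun c : ℕ => C < c), (Nat.gcd n c : ℝ) / C := by
        refine Finset.sum_le_sum fun c hc => ?_
        have hCc : C < c := (Finset.mem_filter.mp hc).2
        exact div_le_div_of_nonneg_left (by positivity) hC0 hCc.le
    _ ≤ ∑ c ∈ Finset.Icc 1 ⌊2 * C⌋₊, (Nat.gcd n c : ℝ) / C :=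
        Finset.sum_le_sum_of_subset_of_nonneg (Finset.filter_subset _ _)
          fun c _ _ => by positivity
    _ = (∑ c ∈ Finset.Icc 1 ⌊2 * C⌋₊, (Nat.gcd c n : ℝ)) / C := by
        rw [Finset.sum_div]
        refine Finset.sum_congr rfl fun c _ => ?_
        rw [Nat.gcd_comm]
    _ ≤ (#n.divisors * (⌊2 * C⌋₊ : ℕ) : ℝ) / C := by
        gcongr
        exact MatomakiMerikoski2023_lemma37_i hn _
    _ ≤ (#n.divisors * (2 * C)) / C := by
        gcongr
        exact Nat.floor_le (by positivity)
    _ = 2 * #n.divisors := by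
        field_simp

/-- **gcd-square sum**: `∑_{1 ≤ s ≤ X} (n, s)² ≤ τ(n) X²` for `n ≥ 1`. [folklore] -/
theorem sum_gcd_sq_le {n : ℕ} (hn : n ≠ 0) (X : ℕ) :
    ∑ s ∈ Finset.Icc 1 X, (Nat.gcd n s : ℝ) ^ 2 ≤ #n.divisors * (X : ℝ) ^ 2 := by
  calc ∑ s ∈ Finset.Icc 1 X, (Nat.gcd n s : ℝ) ^ 2
      ≤ ∑ s ∈ Finset.Icc 1 X, (X : ℝ) * (Nat.gcd s n : ℝ) := by
        refine Finset.sum_le_sum fun s hs => ?_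
        have hsX : s ≤ X := (Finset.mem_Icc.mp hs).2
        have hs1 : 1 ≤ s := (Finset.mem_Icc.mp hs).1
        have hgs : Nat.gcd n s ≤ s := Nat.le_of_dvd hs1 (Nat.gcd_dvd_right n s)
        have h1 : (Nat.gcd n s : ℝ) ≤ X := by exact_mod_cast hgs.trans hsX
        rw [sq, Nat.gcd_comm s n]
        exact mul_le_mul_of_nonneg_right h1 (by positivity)
    _ = (X : ℝ) * ∑ s ∈ Finset.Icc 1 X, (Nat.gcd s n : ℝ) := (Finset.mul_sum _ _ _).symm
    _ ≤ (X : ℝ) * (#n.divisors * X) := by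
        gcongr
        exact MatomakiMerikoski2023_lemma37_i hn _
    _ = #n.divisors * (X : ℝ) ^ 2 := by ring

/-! ### Slices of a five-variable weight -/

/-- The `d`-derivatives of a slice are the mixed derivatives of index `(0, j, 0, 0, 0)`. [folklore] -/
theorem iteratedDeriv_slice_d (g : ℝ → ℝ → ℝ → ℝ → ℝ → ℂ) (j : ℕ) (c x n r s : ℝ) :
    iteratedDeriv j (fun d => g c d n r s) x = mixedDeriv ![0, j, 0, 0, 0] g c x n r s := by
  simp [mixedDeriv]

/-- A slice of a smooth five-variable weight is smooth. [folklore] -/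
theorem contDiff_slice_d {g : ℝ → ℝ → ℝ → ℝ → ℝ → ℂ}
    (hg : ContDiff ℝ ∞ (fun p : Fin 5 → ℝ => g (p 0) (p 1) (p 2) (p 3) (p 4))) (c n r s : ℝ) :
    ContDiff ℝ ∞ (fun d => g c d n r s) := by
  have hemb : ContDiff ℝ ∞ (fun d : ℝ => (![c, d, n, r, s] : Fin 5 → ℝ)) := by
    rw [contDiff_pi]
    intro i
    fin_cases i <;> simp <;> fun_prop
  have h2 : (fun d => g c d n r s) =
      (fun p : Fin 5 → ℝ => g (p 0) (p 1) (p 2) (p 3) (p 4)) ∘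
        (fun d : ℝ => (![c, d, n, r, s] : Fin 5 → ℝ)) := by
    funext d; simp
  rw [h2]
  exact hg.comp hemb

/-- The topological support of every derivative of `F` lies in that of `F`. [folklore] -/
theorem tsupport_iteratedDeriv_subset' (F : ℝ → ℂ) (j : ℕ) :
    tsupport (iteratedDeriv j F) ⊆ tsupport F := by
  induction j with
  | zero => simp
  | succ j ih => rw [iteratedDeriv_succ]; exact tsupport_deriv_subset.trans ih

/-- **Derivative bounds for a slice localised at `d ∼ D`.**  If `F` vanishes unless
`D < x ≤ 2D` (`D ≥ 1`) and `|F⁽ʲ⁾(x)| ≤ K_j (x^{-j})^{1-ε₀}` for `x > 0` (`ε₀ ≤ 1`), then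
`|F⁽ʲ⁾| ≤ K_j (D^{-j})^{1-ε₀}` everywhere, `F⁽ʲ⁾` is supported in `[-2D, 2D]`, and
`‖F⁽ʲ⁾‖₁ ≤ 4D·K_j (D^{-j})^{1-ε₀}`. [folklore] -/
theorem slice_iteratedDeriv_bounds {F : ℝ → ℂ} (hF : ContDiff ℝ ∞ F) {D : ℝ} (hD : 1 ≤ D)
    (hsupp : ∀ x, F x ≠ 0 → D < x ∧ x ≤ 2 * D) {j : ℕ} {Kj ε₀ : ℝ} (hε₀ : ε₀ ≤ 1)
    (hder : ∀ x, 0 < x → ‖iteratedDeriv j F x‖ ≤ Kj * (x ^ (-(j : ℝ))) ^ (1 - ε₀)) :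
    (∀ x, ‖iteratedDeriv j F x‖ ≤ Kj * (D ^ (-(j : ℝ))) ^ (1 - ε₀)) ∧
      Function.support (iteratedDeriv j F) ⊆ Set.Icc (-(2 * D)) (2 * D) ∧
      ∫ t, ‖iteratedDeriv j F t‖ ≤ 2 * (2 * D) * (Kj * (D ^ (-(j : ℝ))) ^ (1 - ε₀)) := by
  have hD0 : 0 < D := by linarith
  -- the topological support of `F` is inside `[D, 2D]`
  have htsF : tsupport F ⊆ Set.Icc D (2 * D) := by
    refine closure_minimal ?_ isClosed_Icc
    intro x hx
    obtain ⟨h1, h2⟩ := hsupp x (Function.mem_support.mp hx)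
    exact ⟨h1.le, h2⟩
  have htsj : Function.support (iteratedDeriv j F) ⊆ Set.Icc D (2 * D) :=
    (subset_tsupport _).trans ((tsupport_iteratedDeriv_subset' F j).trans htsF)
  -- `K_j ≥ 0` unless everything vanishes: we argue pointwise
  have hbound : ∀ x, ‖iteratedDeriv j F x‖ ≤ Kj * (D ^ (-(j : ℝ))) ^ (1 - ε₀) := by
    intro x
    by_cases hx : x ∈ Set.Icc D (2 * D)
    · have hx0 : 0 < x := hD0.trans_le hx.1
      refine (hder x hx0).trans ?_
      have hKj : 0 ≤ Kj := by
        have := (norm_nonneg _).trans (hder x hx0)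
        have hpos : 0 < (x ^ (-(j : ℝ))) ^ (1 - ε₀) := by positivity
        nlinarith
      refine mul_le_mul_of_nonneg_left ?_ hKj
      refine Real.rpow_le_rpow (by positivity) ?_ (by linarith)
      exact Real.rpow_le_rpow_of_nonpos hD0 hx.1 (by simp)
    · have h0 : iteratedDeriv j F x = 0 := by
        by_contra hne
        exact hx (htsj (Function.mem_support.mpr hne))
      rw [h0, norm_zero]
      -- the right-hand side is the bound at the point `2D`, which is `≥ 0` as soon as some
      -- derivative is non-zero there; in general we use the bound at `x = 2D > 0`
      have := (norm_nonneg _).trans (hder (2 * D) (by linarith))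
      have hKj : 0 ≤ Kj ∨ Kj < 0 := le_or_gt 0 Kj
      rcases hKj with hKj | hKj
      · positivity
      · -- `Kj < 0` contradicts the bound at `2D`
        have hpos : 0 < ((2 * D) ^ (-(j : ℝ))) ^ (1 - ε₀) := by positivity
        nlinarith
  refine ⟨hbound, htsj.trans (Set.Icc_subset_Icc (by linarith) le_rfl), ?_⟩
  exact integral_norm_le_of_support (hF.continuous_iteratedDeriv j (by exact_mod_cast le_top))
    (by linarith) hbound (htsj.trans (Set.Icc_subset_Icc (by linarith) le_rfl))

/-- **`‖𝓕F(0)‖ ≤ 4D·sup|F|`** for `F` continuous, supported in `(D, 2D]`, `|F| ≤ K₀`. [folklore] -/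
theorem norm_fourier_zero_le {F : ℝ → ℂ} (hF : Continuous F) {D K₀ : ℝ} (hD : 1 ≤ D)
    (hsupp : ∀ x, F x ≠ 0 → D < x ∧ x ≤ 2 * D) (hK : ∀ x, ‖F x‖ ≤ K₀) :
    ‖𝓕 F 0‖ ≤ 2 * (2 * D) * K₀ := by
  refine (norm_fourier_le_integral_norm F 0).trans ?_
  refine integral_norm_le_of_support hF (by linarith) hK ?_
  intro x hx
  obtain ⟨h1, h2⟩ := hsupp x (Function.mem_support.mp hx)
  exact ⟨by linarith, h2⟩

end KloostermanQuintilinear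

end Literature.NumberTheory.Sieve

end
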